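import Literature.Geometry.Lorentzian.KerrLeafEnergyComparison
import HarnessLib

/-!
# The flux of an arbitrary multiplier current through the leaves and slices is bounded by the
# `V`-energy density: `|T[ψ](W, Z)| ≤ 2 (∑_μ |Z^μ|) T[ψ](V, W)` in the far region

(family `gr`; infrastructure for the far-region estimates behind statement **gr.S24** — the boundary
terms of the Morawetz / large-`r` currents of Dafermos–Rodnianski–Shlapentokh-Rothman, arXiv:1402.7034,
Prop. 4.6.1, and Moschidis, arXiv:1509.08489, Lemma 4.1 ("the boundary terms are controlled by the
`J^T` energy"); namespace `Literature.Geometry.Lorentzian.Kerr`)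

For a future-directed timelike `W` (the normal of a leaf `Σ̃_τ(h♯_{R₁})` or of a slice) the
covector `T[ψ](W, ·)` is the energy–momentum density measured by `W`; by the dominant energy
condition it is causal, so *all* its components are controlled by its time component. Concretely,
at a point of the Kerr exterior with `H ≤ 1/8` the vectors `∂_{t*} ± ½ ∂_i` are future-directed
timelike (`g = η + 2Hℓ ⊗ ℓ`), whence (`LorentzianMetric.stressEnergy_nonneg_of_isTimelike`)

* `Kerr.abs_stressEnergy_basisVector_succ_le`: `|T(W, ∂_i)| ≤ 2 T(W, ∂_{t*})`;
* `Kerr.abs_stressEnergy_le_sum_abs_mul`: **`|T[ψ](W, Z)| ≤ 2 (∑_μ |Z^μ|) T[ψ](V, W)`** for every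
  vector `Z` (expand `Z = ∑ Z^μ ∂_μ`; `T(∂_{t*}, W) ≤ T(V, W)` by
  `Kerr.stressEnergy_basisVector_zero_le_timeVector`);
* the coordinate form `Kerr.abs_sum_multiplierCurrent_mul_le_leafDensity`: for a multiplier field
  `X` and the graph conormal `n` of a height `F` whose leaf normal `W = −g♯n` is future timelike,
  `|∑_μ (J^X)^μ n_μ| ≤ 2 (∑_α |X^α|) (−∑_μ (J^V)^μ n_μ)` — the flux density of *any* multiplier
  current with bounded components through a leaf is bounded by the `V`-flux density
  `Kerr.leafFluxDensity` (through which both degenerate in the same way as the leaf becomes null),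
  and likewise through the slices (`F = 0`, `W = V`).

This is the pointwise input by which the leaf and (smeared) slice boundary terms of the currents
`f J^X[ψ̃]`, `X = f(r)∂_r` (Morawetz, large-`r`), are bounded by `Kerr.leafFlux` in the far-region
estimates; for the `r^p` currents (`X = r^p L`, unbounded components) the sharper null structure is
needed instead. No definitions, no named facts (D-0026).

## References

* M. Dafermos, I. Rodnianski, Y. Shlapentokh-Rothman, arXiv:1402.7034 = Ann. of Math. 183 (2016),
  §2.3 (currents), §4.6, Prop. 4.6.1 (key `DafermosRodnianskiShlapentokhrothman2014`).
* G. Moschidis, arXiv:1509.08489 = Ann. PDE 2 (2016), Lemma 4.1 (boundary terms of the Morawetz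
  current controlled by the `J^T`-energy) (key `Moschidis2016`).
* S. W. Hawking, G. F. R. Ellis (1973), §4.3 (dominant energy condition) (key `HawkingEllis1973`).
-/

noncomputable section

open Bundle Set TopologicalSpace Filter
open scoped Manifold ContDiff Topology

namespace Literature.Geometry.Lorentzian

namespace Kerr

variable [Facts]

omit [Facts] in
/-- `g(∂_{t*}, ∂_i) = 2H ℓ_i` (`ℓ₀ = 1`; `η(∂₀, ∂_i) = 0`). [cite: KerrSchild1965, §2] -/
theorem bilin_basisVector_zero_basisVector_succ (M a : ℝ) (x : E4) (i : Fin 3) :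
    bilin M a x (E4.basisVector 0) (E4.basisVector i.succ) =
      2 * scalarH M a x * nullCovectorFun a x i.succ := by
  rw [bilin_apply, nullCovector_basisVector_zero]
  have hη : Minkowski.bilin (E4.basisVector 0) (E4.basisVector i.succ) = 0 := by
    rw [Minkowski.bilin_basisVector_zero_left]
    simp [E4.basisVector, Fin.succ_ne_zero]
  have hl : nullCovector a x (E4.basisVector i.succ) = nullCovectorFun a x i.succ := by
    simp [nullCovector, E4.covector_apply, E4.basisVector]
  rw [hη, hl]
  ring

omit [Facts] in
/-- `g(∂_i, ∂_i) = 1 + 2H ℓ_i²`. [cite: KerrSchild1965, §2] -/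
theorem bilin_basisVector_succ_self (M a : ℝ) (x : E4) (i : Fin 3) :
    bilin M a x (E4.basisVector i.succ) (E4.basisVector i.succ) =
      1 + 2 * scalarH M a x * nullCovectorFun a x i.succ ^ 2 := by
  rw [bilin_apply]
  have hη : Minkowski.bilin (E4.basisVector i.succ) (E4.basisVector i.succ) = 1 := by
    simp [Minkowski.bilin_apply, E4.basisVector, Fin.succ_ne_zero]
  have hl : nullCovector a x (E4.basisVector i.succ) = nullCovectorFun a x i.succ := by
    simp [nullCovector, E4.covector_apply, E4.basisVector]
  rw [hη, hl]
  ring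

/-- **`∂_{t*} ± ½ ∂_i` is future-directed timelike where `H ≤ 1/8`**:
`g = (−1 + 2H) ± 2Hℓ_i + ¼(1 + 2Hℓ_i²) ≤ −¾ + 4.5 H < 0` (`|ℓ_i| ≤ 1`), and `g(V, ·) = −1`.
[folklore] -/
theorem isFutureDirected_basisVector_zero_add_smul {M a : ℝ} (hM : 0 ≤ M)
    (x : region a (rPlus M a)) (hH : scalarH M a x.1 ≤ 1 / 8) (i : Fin 3) {c : ℝ}
    (hc : |c| ≤ 1 / 2) :
    (smoothMetric M a (rPlus M a)).IsTimelike (x := x)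
        (E4.basisVector 0 + c • E4.basisVector i.succ) ∧
      ((timeOrientation M a (rPlus M a) hM).ofLE le_top :
        TimeOrientation (smoothMetric M a (rPlus M a))).IsFutureDirected (x := x)
          (E4.basisVector 0 + c • E4.basisVector i.succ) := by
  have hx := radius_pos_of_mem_region x.2
  have hl1 : |nullCovectorFun a x.1 i.succ| ≤ 1 := by
    have h := abs_nullVector_le_one hx i.succ
    rw [nullVector_apply, if_neg (Fin.succ_ne_zero i), one_mul] at h
    exact h
  have hH0 : 0 ≤ scalarH M a x.1 := scalarH_nonneg hM a x.1
  have hval : bilin M a x.1 (E4.basisVector 0 + c • E4.basisVector i.succ)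
      (E4.basisVector 0 + c • E4.basisVector i.succ) =
      (-1 + 2 * scalarH M a x.1) + 2 * c * (2 * scalarH M a x.1 * nullCovectorFun a x.1 i.succ) +
        c ^ 2 * (1 + 2 * scalarH M a x.1 * nullCovectorFun a x.1 i.succ ^ 2) := by
    simp only [map_add, map_smul, add_apply, smul_apply, smul_eq_mul,
      bilin_basisVector_zero_basisVector_zero, bilin_basisVector_zero_basisVector_succ,
      bilin_basisVector_succ_self]
    rw [bilin_symm M a x.1 (E4.basisVector i.succ) (E4.basisVector 0),
      bilin_basisVector_zero_basisVector_succ]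
    ring
  have ht : (smoothMetric M a (rPlus M a)).IsTimelike (x := x)
      (E4.basisVector 0 + c • E4.basisVector i.succ) := by
    show bilin M a x.1 _ _ < 0
    rw [hval]
    have hc2 : c ^ 2 ≤ 1 / 4 := by
      have := abs_le.1 hc
      nlinarith
    have hcl : |c * nullCovectorFun a x.1 i.succ| ≤ 1 / 2 := by
      rw [abs_mul]
      calc |c| * |nullCovectorFun a x.1 i.succ| ≤ 1 / 2 * 1 :=
            mul_le_mul hc hl1 (abs_nonneg _) (by norm_num)
        _ = 1 / 2 := by ring
    have hcl' := (abs_le.1 hcl)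
    have hl2 : nullCovectorFun a x.1 i.succ ^ 2 ≤ 1 := by
      have := abs_le.1 hl1
      nlinarith
    nlinarith [mul_le_mul_of_nonneg_left hcl'.2 (by linarith : (0:ℝ) ≤ 4 * scalarH M a x.1),
      mul_le_mul_of_nonneg_left hl2 (by positivity : (0:ℝ) ≤ 2 * scalarH M a x.1 * c ^ 2),
      mul_nonneg hH0 (sq_nonneg c)]
  refine ⟨ht, ht.isCausal, ?_⟩
  show bilin M a x.1 (timeVector M a x.1) (E4.basisVector 0 + c • E4.basisVector i.succ) < 0
  rw [bilin_timeVector hx]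
  simp [E4.basisVector, Fin.succ_ne_zero]

/-! ### Components of the energy–momentum density measured by a future timelike `W` -/

/-- **`|T[ψ](W, ∂_i)| ≤ 2 T[ψ](W, ∂_{t*})`** at exterior points with `H ≤ 1/8`, for every
future-directed timelike `W` (dominant energy condition applied to `∂_{t*} ± ½∂_i`).
Hawking–Ellis 1973, §4.3. [cite: HawkingEllis1973, §4.3] -/
theorem abs_stressEnergy_basisVector_succ_le {M a : ℝ} (hM : 0 ≤ M) (x : region a (rPlus M a))
    (hH : scalarH M a x.1 ≤ 1 / 8) {W : E4}
    (hW : ((timeOrientation M a (rPlus M a) hM).ofLE le_top :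
      TimeOrientation (smoothMetric M a (rPlus M a))).IsFutureDirected (x := x) W)
    (hWt : (smoothMetric M a (rPlus M a)).IsTimelike (x := x) W) (ψ : region a (rPlus M a) → ℝ)
    (i : Fin 3) :
    |(smoothMetric M a (rPlus M a)).stressEnergy ψ x W (E4.basisVector i.succ)| ≤
      2 * (smoothMetric M a (rPlus M a)).stressEnergy ψ x W (E4.basisVector 0) := by
  have key : ∀ c : ℝ, |c| ≤ 1 / 2 →
      0 ≤ (smoothMetric M a (rPlus M a)).stressEnergy ψ x W (E4.basisVector 0) +
        c * (smoothMetric M a (rPlus M a)).stressEnergy ψ x W (E4.basisVector i.succ) := by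
    intro c hc
    obtain ⟨hZt, hZ⟩ := isFutureDirected_basisVector_zero_add_smul hM x hH i hc
    have hWZ : (smoothMetric M a (rPlus M a)).val x W (E4.basisVector 0 + c • E4.basisVector i.succ) < 0 :=
      hW.val_lt_zero _ hWt hZ
    have h := LorentzianMetric.stressEnergy_nonneg_of_isTimelike _ hWt hZt hWZ ψ
    set L : E4 →ₗ[ℝ] ℝ := (smoothMetric M a (rPlus M a)).stressEnergy ψ x W with hL
    have hexp : L (E4.basisVector 0 + c • E4.basisVector i.succ) =
        L (E4.basisVector 0) + c * L (E4.basisVector i.succ) := by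
      rw [map_add, map_smul, smul_eq_mul]
    have h' : 0 ≤ L (E4.basisVector 0 + c • E4.basisVector i.succ) := h
    change 0 ≤ L (E4.basisVector 0) + c * L (E4.basisVector i.succ)
    linarith [h', hexp]
  have h1 := key (1 / 2) (by norm_num)
  have h2 := key (-(1 / 2)) (by norm_num)
  rw [abs_le]
  constructor <;> linarith

/-- **The energy–momentum density measured by a future timelike `W` is controlled by the
`V`-energy**: at exterior points with `H ≤ 1/8` (e.g. `‖x⃗‖ ≥ 9M`), for `M > 0`, every future-directed
timelike `W` and every vector `Z`,
`|T[ψ](W, Z)| ≤ 2 (∑_μ |Z^μ|) T[ψ](V, W)` (`Z = ∑ Z^μ∂_μ`; `|T(W, ∂_i)| ≤ 2T(W, ∂_{t*})`,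
`0 ≤ T(W, ∂_{t*}) = T(∂_{t*}, W) ≤ T(V, W)`). DRSR arXiv:1402.7034, §4.6; Moschidis arXiv:1509.08489,
Lemma 4.1. [cite: Moschidis2016, Lemma 4.1] -/
theorem abs_stressEnergy_le_sum_abs_mul {M a : ℝ} (hM : 0 < M) (x : region a (rPlus M a))
    (hH : scalarH M a x.1 ≤ 1 / 8) {W : E4}
    (hW : ((timeOrientation M a (rPlus M a) hM.le).ofLE le_top :
      TimeOrientation (smoothMetric M a (rPlus M a))).IsFutureDirected (x := x) W)
    (hWt : (smoothMetric M a (rPlus M a)).IsTimelike (x := x) W) (ψ : region a (rPlus M a) → ℝ)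
    (Z : E4) :
    |(smoothMetric M a (rPlus M a)).stressEnergy ψ x W Z| ≤
      2 * (∑ μ, |Z μ|) * (smoothMetric M a (rPlus M a)).stressEnergy ψ x (timeVector M a x.1) W := by
  set B := (smoothMetric M a (rPlus M a)).stressEnergy ψ x with hB
  have h2H : 2 * scalarH M a x.1 < 1 := by linarith
  -- `T(W, ∂₀) = T(∂₀, W)`, between `0` and `T(V, W)`
  have hsym0 : B W (E4.basisVector 0) = B (E4.basisVector 0) W :=
    (smoothMetric M a (rPlus M a)).toPseudoRiemannianMetric.stressEnergy_symm ψ x _ _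
  have h0nn : 0 ≤ B (E4.basisVector 0) W := stressEnergy_basisVector_zero_nonneg hM.le x h2H hW hWt ψ
  have h0le : B (E4.basisVector 0) W ≤ B (timeVector M a x.1) W :=
    stressEnergy_basisVector_zero_le_timeVector hM x hW hWt ψ
  -- expand `Z` in the coordinate basis
  have hZ : B W Z = ∑ μ, Z μ * B W (E4.basisVector μ) := by
    set L : E4 →ₗ[ℝ] ℝ := B W with hL
    change L Z = ∑ μ, Z μ * L (E4.basisVector μ)
    conv_lhs => rw [eq_sum_basisVector Z, map_sum]
    exact Finset.sum_congr rfl fun μ _ ↦ by rw [map_smul, smul_eq_mul]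
  have hcomp : ∀ μ, |B W (E4.basisVector μ)| ≤ 2 * B (timeVector M a x.1) W := by
    intro μ
    refine Fin.cases ?_ (fun i ↦ ?_) μ
    · rw [hsym0, abs_of_nonneg h0nn]; linarith
    · calc |B W (E4.basisVector i.succ)| ≤ 2 * B W (E4.basisVector 0) :=
            abs_stressEnergy_basisVector_succ_le hM.le x hH hW hWt ψ i
        _ ≤ 2 * B (timeVector M a x.1) W := by rw [hsym0]; linarith
  rw [hZ]
  calc |∑ μ, Z μ * B W (E4.basisVector μ)| ≤ ∑ μ, |Z μ * B W (E4.basisVector μ)| :=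
        Finset.abs_sum_le_sum_abs _ _
    _ ≤ ∑ μ, |Z μ| * (2 * B (timeVector M a x.1) W) := Finset.sum_le_sum fun μ _ ↦ by
        rw [abs_mul]; exact mul_le_mul_of_nonneg_left (hcomp μ) (abs_nonneg _)
    _ = 2 * (∑ μ, |Z μ|) * B (timeVector M a x.1) W := by rw [← Finset.sum_mul]; ring

/-! ### Coordinate form: the flux of any multiplier current through a leaf -/

/-- **The flux density of any multiplier current through a leaf is bounded by the `V`-flux
density.** Let `F` be a height whose leaf normal `W = −g♯n`, `n = graphConormal F x⃗`, is
future-directed timelike at the exterior point `x` with `H(x) ≤ 1/8`, `ψ` represented by `Φ`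
differentiable at `x`, and `X` any multiplier field. Then
`|∑_μ (J^X)^μ(x) n_μ| ≤ 2 (∑_α |X^α(x)|) (−∑_μ (J^V)^μ(x) n_μ)`
(`∑(J^X)^μ n_μ = T(X, g♯n) = −T(W, X)`, `KerrSchildLeafCurrents.lean`). For the Kerr–Schild slices take
`F = 0` (`W = V`). DRSR arXiv:1402.7034, §4.6; Moschidis arXiv:1509.08489, Lemma 4.1.
[cite: Moschidis2016, Lemma 4.1] -/
theorem abs_sum_multiplierCurrent_mul_le_leafDensity {M a : ℝ} (hM : 0 < M)
    {ψ : region a (rPlus M a) → ℝ} {Φ : E4 → ℝ} (hψ : ∀ y, ψ y = Φ y) (F : E3 → ℝ)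
    (x : region a (rPlus M a)) (hH : scalarH M a x.1 ≤ 1 / 8) (hΦ : DifferentiableAt ℝ Φ x)
    (hW : ((timeOrientation M a (rPlus M a) hM.le).ofLE le_top :
      TimeOrientation (smoothMetric M a (rPlus M a))).IsFutureDirected (x := x) (leafNormal M a F x) ∧
      (smoothMetric M a (rPlus M a)).IsTimelike (x := x) (leafNormal M a F x))
    (X : E4 → Fin 4 → ℝ) :
    |∑ μ, KerrSchild.multiplierCurrent (inverseMetric M a) X Φ x μ * graphConormal F (E4.spatial x.1) μ| ≤
      2 * (∑ α, |X x α|) *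
        -∑ μ, KerrSchild.multiplierCurrent (inverseMetric M a) (fun z α ↦ timeVector M a z α) Φ x μ *
          graphConormal F (E4.spatial x.1) μ := by
  -- the vector `Z = X(x)`
  set Z : E4 := WithLp.toLp 2 (X x.1) with hZ
  have hXZ : ∀ α, X x.1 α = Z α := fun α ↦ by simp [hZ]
  have hflux := sum_multiplierCurrent_mul_eq_stressEnergy M a (rPlus M a) hψ x hΦ hXZ
    (graphConormal F (E4.spatial x.1))
  have hV := stressEnergy_timeVector_leafNormal_eq M a hψ F x hΦ
  -- `coSharp n = −W`
  have hWeq : coSharp M a x.1 (E4.covector (graphConormal F (E4.spatial x.1)) : E4 →L[ℝ] ℝ) =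
      -leafNormal M a F x := by
    rw [leafNormal_eq_neg_coSharp, neg_neg]
  rw [hflux, hWeq, ← hV]
  have hneg : (smoothMetric M a (rPlus M a)).stressEnergy ψ x Z (-leafNormal M a F x) =
      -(smoothMetric M a (rPlus M a)).stressEnergy ψ x (leafNormal M a F x) Z := by
    set L : E4 →ₗ[ℝ] ℝ := (smoothMetric M a (rPlus M a)).stressEnergy ψ x Z with hL
    have h1 : L (-leafNormal M a F x) = -L (leafNormal M a F x) := L.map_neg _
    have h2 : L (leafNormal M a F x) = (smoothMetric M a (rPlus M a)).stressEnergy ψ x (leafNormal M a F x) Z :=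
      (smoothMetric M a (rPlus M a)).toPseudoRiemannianMetric.stressEnergy_symm ψ x Z _
    change L (-leafNormal M a F x) = _
    rw [h1, h2]
  rw [hneg, abs_neg,
    (smoothMetric M a (rPlus M a)).toPseudoRiemannianMetric.stressEnergy_symm ψ x (timeVector M a x.1)]
  have h := abs_stressEnergy_le_sum_abs_mul hM x hH hW.1 hW.2 ψ Z
  have hsum : (∑ μ, |Z μ|) = ∑ α, |X x.1 α| := Finset.sum_congr rfl fun α _ ↦ by rw [hXZ]
  rw [hsum] at h
  rw [(smoothMetric M a (rPlus M a)).toPseudoRiemannianMetric.stressEnergy_symm ψ x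
    (leafNormal M a F x) (timeVector M a x.1)]
  exact h

end Kerr

end Literature.Geometry.Lorentzian
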